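import Summits.QuantumFields.YangMills.Theorems.LuscherReductionTwistedTraceScalingZPEBounds
import Summits.QuantumFields.YangMills.Theorems.LuscherReductionTwistedTraceScalingToronGain
import Summits.QuantumFields.YangMills.Theorems.LuscherReductionTwistedTraceScalingCombFlat
import HarnessLib

/-!
# R17 — the zero-point KINK of `zpeSum` at the vacuum along the valley (negative lemma for the C4 design, by name)

Standing crux disprover `ym-cdisprove-20203-1` (gen 15), lane `Theorems/TwistedTraceScaling/Negative/`, `--supports stmt-QuantumFields-20203`.

HONEST FRAMING.  This file concerns a DESIGN STEP (lane A `ym-luscher-20007-p1`, `COARSE-DESIGN.md` §20.3, 2026-08-28) for the still-OPEN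
copy C4 = `InnerNoIntruderOneOrbitAt` of `stub_fixedLatticeTraceLaw`, a stub of a child (`LuscherReduction.TwistedTraceScaling`, femto rung R2b1) of a
CONDITIONAL reduction route.  It is not `¬TwistedTraceScaling`, not `¬InnerNoIntruderOneOrbitAt`, not a statement about a mass gap, not Clay.
It kills one proposed LEMMA TEXT and says what the correct object is; C4 itself stays plausible.

THE CLAIM UNDER ATTACK (verbatim, `COARSE-DESIGN.md` §20.3): «the c-dependence of the stiff zero-point sum must be controlled
(|zpeSum(c ⊕ 0) − 6Z₀| = O(n|c|²) = O(β^{−1/2}) = o(λ_b) on the one-site bulk |c| ≲ (L³β)^{−1/4}: fine numerically, but it is a SECOND-order statement —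
the first-order Lipschitz bound `abs_zpeSum_sub_le` (O(|c|) = O(β^{−1/4})) is NOT enough; needed: zpeSum is even/C² in c at the vacuum, i.e. a second-order
perturbation bound for Σ arsinh(√λᵢ/2) under D_1̄ → D_{constLift c}, D linear in c).»

VERDICT (kernel-checked below): for the tree's `zpeSum` (`…ValleySkeleton`: ALL `3|E|` singular values of the covariant curl, INCLUDING the momentum-zero
charged modes) the wanted second-order bound is FALSE, for every `L ≥ 1` and every `κ > 0`: along the commuting constant backgrounds
`c = diag(θ)`, `constLift c = abelianCfg L θ = V_θ` (`Flat.abelianCfg_eq_constLift`, `…CombFlat`),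
* `zpeSum_constLift_diag_sub_vacuum_ge`   : `8·gain1Slope L κ·|θ_k| ≤ zpeSum L κ (constLift L (diag θ)) − 6·toronZPE L κ 0 0` whenever `|θ_k| ≤ π/(2L)`
  (`gain1Slope L κ > 0`, `…ToronGain`), i.e. the excess is bounded BELOW by a LINEAR function of `|c|` — a conical kink, not a `C²` minimum;
* `not_zpeSum_secondOrder_at_vacuum`     : `¬ ∃ C δ₀ > 0, ∀ θ, (∀ k, |θ_k| < δ₀) → |zpeSum L κ (abelianCfg L θ) − 6Z₀| ≤ C·Σ_k θ_k²`;
* `not_zpeSum_secondOrder_constLift`     : the same with `constLift L (fun e => diagSU2 (θ e.2))` written out («under D_1̄ → D_{constLift c}»).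
So `|zpeSum(c ⊕ 0) − 6Z₀|` on §20.3's own one-site bulk `|c| ≍ (L³β)^{−1/4}` is genuinely `≍ β^{−1/4} ≫ λ_b ≍ β^{−1/3}`: the Lipschitz order of `abs_zpeSum_sub_le`
is the TRUE order there, and no «second-order perturbation bound for Σ arsinh(√λᵢ/2) under D_1̄ → D_{constLift c}» exists.

CONSISTENCY REMARK.  The linear excess is the SAME first-order twist gain lane A used (correctly) in `COARSE-DESIGN` (C5) / `…ToronGain`
(`toronZPE_zero_add_slope_mul_norm_le`) to expel valley states in C3: one object cannot be `≥ c_L·|c|` for C3 and `O(|c|²)` for C4.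

WHAT THE CORRECT OBJECT IS (print): van Baal–Koller, *QCD on a torus, and electric flux energies from tunneling*, Ann. Phys. 174 (1987), §4 eq. (4.4),
p. 314: «V′₁(C) is the one-loop effective potential along the vacuum valley, where the prime denotes that we have excluded the contribution from the constant
modes: V′₁(C) = V₁(C) − 2|C|/L.»  [cite: VanbaalKoller1987, §4 eq. (4.3)–(4.5), p. 314]  In tree terms (`zpeSum_abelianCfg`):
`zpeSum L κ (V_θ) − 6Z₀ = 4·[toronZPE L κ 0 (2θ) − toronZPE L κ 0 0]`, and the `j = 0` summand of `toronZPE L κ 0 (2θ)` is `modeZPE(κ·lap3 L (2θ) 0) =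
½arcosh(1 + κΣ_k(2 − 2cos 2θ_k)) ≍ √(2κ)·|θ|` — the four momentum-zero charged («W») modes, whose zero-point energy is LINEAR in the background; they are among the
nine constant modes that the one-site kernel `transferKernel_constLift` already treats EXACTLY, so the stiff Gaussian of a correct C4 slice form must run over the
momenta `j ≠ 0` only (`zpeSum′`), and THAT sum is even and real-analytic at `θ = 0` (all its arguments `κ·lap3 L 0 j`, `j ≠ 0`, are `> 0`), hence `O_{L,κ}(|θ|²)`.
The repaired §20.3 target is therefore: a second-order bound for `zpeSum′ := zpeSum − 4·modeZPE(κ·lap3 L (2θ) 0)`-type primed sums (momentum-zero block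
removed), not for `zpeSum`.

Contents: §1 the exact excess formula and its sign (toron minimality); §2 the linear lower bound (kink) in `AddCircle`-norm and in small-angle form, for
`abelianCfg` and for `constLift ∘ diag`; §3 the second-order bound is false (explicit witness `θ = (t,0,0)`,
`t = min(δ₀/2, π/(2L), 4·gain1Slope/max(C,1))`) and the quantified exact-first-order form.  No `def`s; pure theorems over tree objects.
-/

namespace Summit.QuantumFields.YangMills.Theorems.TwistedTraceScaling.Negative.R17

open Real Finset
open scoped BigOperators
open Literature.MathematicalPhysics.QuantumFieldTheory
open Literature.MathematicalPhysics.QuantumLattice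
open Summit.QuantumFields.YangMills.Theorems.FemtoTransferGap
open Summit.QuantumFields.YangMills.Theorems.FemtoTransferGap.TwoLattice
open Summit.QuantumFields.YangMills.Theorems.FemtoTransferGap.TwoLattice.Toron

variable (L : ℕ) [NeZero L]

/-! ## §1 The exact excess of `zpeSum` over the vacuum along the valley -/

/-- `zpeSum L κ V_θ − 6Z₀ = 4·(toronZPE L κ 0 (2θ) − toronZPE L κ 0 0)`: only the four charged transverse branches move (exact, from `zpeSum_abelianCfg`). [folklore] -/
theorem zpeSum_abelianCfg_sub_vacuum (θ : Fin 3 → ℝ) (κ : ℝ) :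
    zpeSum L κ (abelianCfg L θ) - 6 * toronZPE L κ 0 0 = 4 * (toronZPE L κ 0 (fun k => 2 * θ k) - toronZPE L κ 0 0) := by
  rw [zpeSum_abelianCfg]; ring

/-- The excess is non-negative (toron minimality, `toronZPE_zero_le`). [cite: Luscher1983, §3] -/
theorem zpeSum_abelianCfg_sub_vacuum_nonneg {κ : ℝ} (hκ : 0 < κ) (θ : Fin 3 → ℝ) :
    0 ≤ zpeSum L κ (abelianCfg L θ) - 6 * toronZPE L κ 0 0 := by
  rw [zpeSum_abelianCfg_sub_vacuum]
  have h := toronZPE_zero_le L hκ (fun k => 2 * θ k)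
  have h0 : toronZPE L κ 0 (fun _ => (0 : ℝ)) = toronZPE L κ 0 0 := rfl
  linarith

/-! ## §2 The KINK: a linear lower bound on the excess -/

/-- ★ **Kink, `AddCircle` form**: `4·gain1Slope L κ·‖(2θ_k : ℝ/(2π/L)ℤ)‖ ≤ zpeSum L κ V_θ − 6Z₀` for every direction `k` (`κ > 0`). [folklore] -/
theorem zpeSum_abelianCfg_sub_vacuum_ge_norm {κ : ℝ} (hκ : 0 < κ) (θ : Fin 3 → ℝ) (k : Fin 3) :
    4 * (gain1Slope L κ * ‖((2 * θ k : ℝ) : AddCircle (2 * Real.pi / L))‖) ≤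
      zpeSum L κ (abelianCfg L θ) - 6 * toronZPE L κ 0 0 := by
  rw [zpeSum_abelianCfg_sub_vacuum]
  have h := toronZPE_zero_add_slope_mul_norm_le L hκ (fun k => 2 * θ k) k
  have h0 : toronZPE L κ 0 (fun _ => (0 : ℝ)) = toronZPE L κ 0 0 := rfl
  linarith

/-- For `|x| ≤ π/L` the `AddCircle (2π/L)`-norm of `x` is `|x|`. [folklore] -/
theorem norm_addCircle_eq_abs {x : ℝ} (hx : |x| ≤ Real.pi / L) : ‖((x : ℝ) : AddCircle (2 * Real.pi / L))‖ = |x| := by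
  have hL : (0 : ℝ) < L := by exact_mod_cast Nat.pos_of_ne_zero (NeZero.ne L)
  have hp : (2 * Real.pi / L : ℝ) ≠ 0 := by positivity
  rw [AddCircle.norm_coe_eq_abs_iff (2 * Real.pi / L) hp]
  rw [abs_of_pos (by positivity : (0 : ℝ) < 2 * Real.pi / L)]
  calc |x| ≤ Real.pi / L := hx
    _ = 2 * Real.pi / L / 2 := by ring

/-- ★★ **Kink, small-angle form**: if `|θ_k| ≤ π/(2L)` then `8·gain1Slope L κ·|θ_k| ≤ zpeSum L κ V_θ − 6Z₀` — the zero-point excess of the tree's `zpeSum` along the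
valley is bounded BELOW by a LINEAR function of the background: a conical kink at the vacuum, not a `C²` minimum. [folklore] -/
theorem zpeSum_abelianCfg_sub_vacuum_ge {κ : ℝ} (hκ : 0 < κ) (θ : Fin 3 → ℝ) (k : Fin 3) (hθ : |θ k| ≤ Real.pi / (2 * L)) :
    8 * gain1Slope L κ * |θ k| ≤ zpeSum L κ (abelianCfg L θ) - 6 * toronZPE L κ 0 0 := by
  have hL : (0 : ℝ) < L := by exact_mod_cast Nat.pos_of_ne_zero (NeZero.ne L)
  have h2 : |2 * θ k| ≤ Real.pi / L := by
    rw [abs_mul, abs_of_pos (by norm_num : (0 : ℝ) < 2)]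
    calc 2 * |θ k| ≤ 2 * (Real.pi / (2 * L)) := by gcongr
      _ = Real.pi / L := by field_simp
  have h := zpeSum_abelianCfg_sub_vacuum_ge_norm L hκ θ k
  rw [norm_addCircle_eq_abs L h2, abs_mul, abs_of_pos (by norm_num : (0 : ℝ) < 2)] at h
  linarith

/-- ★★ **Kink under `D_1̄ → D_{constLift c}`** (the form named in `COARSE-DESIGN` §20.3), commuting `c = diag θ`:
`8·gain1Slope L κ·|θ_k| ≤ zpeSum L κ (constLift L (diag θ)) − 6Z₀` for `|θ_k| ≤ π/(2L)`. [folklore] -/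
theorem zpeSum_constLift_diag_sub_vacuum_ge {κ : ℝ} (hκ : 0 < κ) (θ : Fin 3 → ℝ) (k : Fin 3) (hθ : |θ k| ≤ Real.pi / (2 * L)) :
    8 * gain1Slope L κ * |θ k| ≤ zpeSum L κ (constLift L (fun e : Edge 3 1 => diagSU2 (θ e.2))) - 6 * toronZPE L κ 0 0 := by
  rw [← Flat.abelianCfg_eq_constLift]; exact zpeSum_abelianCfg_sub_vacuum_ge L hκ θ k hθ

/-! ## §3 The second-order bound of §20.3 is FALSE -/

/-- ★★★ **NOT SECOND ORDER** (`COARSE-DESIGN` §20.3's wanted bound is false for the tree's `zpeSum`): for every `L ≥ 1`, `κ > 0` there are NO constants `C`, `δ₀ > 0`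
with `|zpeSum L κ V_θ − 6Z₀| ≤ C·Σ_k θ_k²` for all `‖θ‖_∞ < δ₀`.  Witness: `θ = (t,0,0)`, `t = min(δ₀/2, π/(2L), 4·gain1Slope L κ/max(C,1))`, where the kink gives
`zpeSum − 6Z₀ ≥ 8·gain1Slope·t > C·t²`. [folklore] -/
theorem not_zpeSum_secondOrder_at_vacuum {κ : ℝ} (hκ : 0 < κ) :
    ¬ ∃ C δ₀ : ℝ, 0 < δ₀ ∧ ∀ θ : Fin 3 → ℝ, (∀ k, |θ k| < δ₀) →
        |zpeSum L κ (abelianCfg L θ) - 6 * toronZPE L κ 0 0| ≤ C * ∑ k, θ k ^ 2 := by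
  rintro ⟨C, δ₀, hδ₀, h⟩
  have hL : (0 : ℝ) < L := by exact_mod_cast Nat.pos_of_ne_zero (NeZero.ne L)
  set c : ℝ := gain1Slope L κ with hc_def
  have hc : 0 < c := gain1Slope_pos L hκ
  set C' : ℝ := max C 1 with hC'_def
  have hC' : 0 < C' := lt_of_lt_of_le one_pos (le_max_right C 1)
  have hCC' : C ≤ C' := le_max_left C 1
  set t : ℝ := min (δ₀ / 2) (min (Real.pi / (2 * L)) (4 * c / C')) with ht_def
  have ht0 : 0 < t := by
    refine lt_min (by linarith) (lt_min (by positivity) (by positivity))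
  have htδ : t < δ₀ := lt_of_le_of_lt (min_le_left _ _) (by linarith)
  have htπ : t ≤ Real.pi / (2 * L) := le_trans (min_le_right _ _) (min_le_left _ _)
  have htc : t ≤ 4 * c / C' := le_trans (min_le_right _ _) (min_le_right _ _)
  -- the witness `θ = (t, 0, 0)`
  set θ : Fin 3 → ℝ := fun k => if k = 0 then t else 0 with hθ_def
  have hθ0 : θ 0 = t := by simp [hθ_def]
  have hθsq : ∑ k, θ k ^ 2 = t ^ 2 := by simp [hθ_def]
  have hθle : ∀ k, |θ k| ≤ |t| := by
    intro k; simp only [hθ_def]; split_ifs <;> simp [abs_nonneg]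
  have hsmall : ∀ k, |θ k| < δ₀ := fun k =>
    lt_of_le_of_lt (hθle k) (by rwa [abs_of_pos ht0])
  have hup := h θ hsmall
  rw [hθsq] at hup
  have hkink := zpeSum_abelianCfg_sub_vacuum_ge L hκ θ 0 (by rw [hθ0, abs_of_pos ht0]; exact htπ)
  rw [hθ0, abs_of_pos ht0] at hkink
  -- `8ct ≤ excess ≤ |excess| ≤ C t² ≤ C' t² ≤ 4 c t`, contradiction with `c t > 0`
  have h1 : 8 * c * t ≤ C * t ^ 2 := le_trans (le_trans hkink (le_abs_self _)) hup
  have h2 : C * t ^ 2 ≤ C' * t ^ 2 := by gcongr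
  have h3 : C' * t ^ 2 ≤ 4 * c * t := by
    have : C' * t ≤ 4 * c := by
      calc C' * t ≤ C' * (4 * c / C') := by gcongr
        _ = 4 * c := by field_simp
    nlinarith
  nlinarith

/-- ★★★ The same, written «under `D_1̄ → D_{constLift c}`» with commuting `c = diag θ` (the exact wording of §20.3): no second-order bound. [folklore] -/
theorem not_zpeSum_secondOrder_constLift {κ : ℝ} (hκ : 0 < κ) :
    ¬ ∃ C δ₀ : ℝ, 0 < δ₀ ∧ ∀ θ : Fin 3 → ℝ, (∀ k, |θ k| < δ₀) →
        |zpeSum L κ (constLift L (fun e : Edge 3 1 => diagSU2 (θ e.2))) - 6 * toronZPE L κ 0 0| ≤ C * ∑ k, θ k ^ 2 := by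
  rintro ⟨C, δ₀, hδ₀, h⟩
  refine not_zpeSum_secondOrder_at_vacuum L hκ ⟨C, δ₀, hδ₀, fun θ hθ => ?_⟩
  rw [Flat.abelianCfg_eq_constLift]; exact h θ hθ

/-- ★★ Quantified first-order form: `∃ c₁ > 0, ∃ θ₀ > 0, ∀ θ, |θ_0| ≤ θ₀ → c₁·|θ_0| ≤ zpeSum L κ V_θ − 6Z₀` (`c₁ = 8·gain1Slope L κ`, `θ₀ = π/(2L)`): the excess is of
EXACT first order along the valley (upper first-order bound: `abs_zpeSum_sub_le`). [folklore] -/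
theorem zpeSum_excess_firstOrder {κ : ℝ} (hκ : 0 < κ) :
    ∃ c₁ θ₀ : ℝ, 0 < c₁ ∧ 0 < θ₀ ∧ ∀ θ : Fin 3 → ℝ, |θ 0| ≤ θ₀ →
        c₁ * |θ 0| ≤ zpeSum L κ (abelianCfg L θ) - 6 * toronZPE L κ 0 0 := by
  have hL : (0 : ℝ) < L := by exact_mod_cast Nat.pos_of_ne_zero (NeZero.ne L)
  refine ⟨8 * gain1Slope L κ, Real.pi / (2 * L), by positivity [gain1Slope_pos L hκ], by positivity, fun θ hθ => ?_⟩
  exact zpeSum_abelianCfg_sub_vacuum_ge L hκ θ 0 hθ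

end Summit.QuantumFields.YangMills.Theorems.TwistedTraceScaling.Negative.R17
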